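import Literature.Probability.Percolation.SlabMSFNoNewCircuit
import HarnessLib

/-!
# Newman–Tassion–Wu 2017, §4 (proof of Theorem 2.4) — the surgered configuration of the gluing
# lemma for invasion, II: Step 2 (`Γ_w`) creates no new circuit; the closed dual surface survives

Topic: `Literature/Probability/Percolation`.  Continuation of `SlabMSFNoNewCircuit.lean` (the
abstract one-needle lemma `IsOpenCircuit.of_needle`, the modified pair set `surgS`, the configurations
`cfgZ = (ω ∖ S) ∪ E(Γ_z)` and `cfgZW = cfgZ ∪ E(Γ_w)`, and "`Γ_min` unchanged by Steps 1 and 3").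
Here:

* `isOpenCircuit_of_cfgZW` — under Step 2's test read in `cfgZ` ("`w` is not joined to `Γ_min`",
  the lane's reading (R2′) of NTW's "if `w ∈ C_{p_c}(z)`, go to Step 3"), every `cfgZW`-open circuit
  with at least three vertices is `cfgZ`-open: the one-needle lemma applied to `Γ_w`, whose end lies on
  `Γ_z ∪ Γ`, every vertex of which is `cfgZ`-joined to `Γ` (`reachable_cfgZ_of_mem_gammaZ`); the
  junction of `Γ_w` with `Γ_z` is the END of the needle and costs nothing.
* `minCircuit_cfgZW` — **(f2) `Γ_min(ω′) = Γ_min(ω)`** after Steps 1–3, under (f1) and the test;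
  `cfgZW_mem_circuitAround`.
* `not_mem_slabConn_of_new_pairs` — a closed dual surface (`ω ∉ X ⟷^B Y`) survives any surgery all
  of whose NEW open pairs have both endpoints over `X` (last-visit argument) — repair (R1): the event
  to carry through the surgery is `D_{2n_i+1,m_i}`, since the plus cylinder `B̄₁^#(z′)`, `z′ ∈ B_{2n_i}`,
  lies over `B_{2n_i+1}` (`planar_mem_sqBox_succ_of_mem_plusEdges`), and the new pairs of `cfgZ`,
  `cfgZW` are plus-cylinder pairs (`mem_plusEdges_of_mem_cfgZ(W)_of_not_mem`).

## Sources

* C. M. Newman, V. Tassion, W. Wu, *Critical percolation and the minimal spanning tree in slabs*,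
  Comm. Pure Appl. Math. 70 (2017) 2084–2120 = arXiv:1512.09107: §4.1, proof of Lemma 4.1, Step 2,
  (f2) ("If the construction uses Step 2, by the same argument, we would have either
  `z(ω) ∈ C_{p_c}(Γ_min(ω))`, or `w(ω) ∈ C_{p_c}(Γ_min(ω))`, or `w(ω) ∈ C_{p_c}(z(ω))`"), and
  "By construction, `ω′ ∈ 𝓑_0 ∩ 𝓑_x ∩ 𝒴_A`" (the event `D`), p. 21 [NewmanTassionWu2017].
-/

noncomputable section

namespace Literature.Probability.Percolation

open MeasureTheory LatticeModels SimpleGraph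

namespace NTW17

variable {k : ℕ}

/-- An open path inside `A` gives reachability in the open graph. [folklore] -/
private theorem reachable_of_openConnIn'' {ω : BondConfig (slab 3 k)} {A : Set (slab 3 k)} {a b : slab 3 k}
    (h : ω ∈ openConnIn A a b) : (openGraph ω).Reachable a b := by
  obtain ⟨_, _, hr⟩ := h
  exact hr.map (SimpleGraph.Embedding.induce A).toHom

/-- Planar-adjacent points are distinct. [folklore] -/
private theorem ne_of_planarAdj'' {z w : ℤ × ℤ} (h : planarAdj z w) : z ≠ w := by
  rintro rfl
  obtain ⟨a, b⟩ := z
  simp only [planarAdj, Prod.mk_add_mk, Prod.mk.injEq] at h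
  omega


/-! ## No new circuit: Step 2 -/

section StepW

variable {ω : BondConfig (slab 3 k)} {Γ : List (slab 3 k)} {z w : slab 3 k}

/-- `Γ_z` is a `cfgZ`-open chain; so each of its vertices is `cfgZ`-joined to its end `g ∈ Γ`.
[cite: NewmanTassionWu2017, §4.1 (Step 1: "Open all the edges in Γ_z")] -/
theorem reachable_cfgZ_of_mem_gammaZ (hz : ∃ g ∈ Γ, planarAdj (planar k z) (planar k g))
    {g : slab 3 k} (hg : nearestOver k Γ (landCol k Γ z) (ht z) = some g)
    {v : slab 3 k} (hv : v ∈ gammaZ k Γ z) : (openGraph (cfgZ k ω Γ z)).Reachable v g := by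
  have hch : (gammaZ k Γ z).IsChain (fun a b => s(a, b) ∈ cfgZ k ω Γ z ∧ a ≠ b) :=
    isChain_of_edgesOf_subset (connector_chain hg (landCol_spec hz).2) Set.subset_union_right
  have hz' : ∀ x ∈ gammaZ k Γ z, x ∈ (Set.univ : Set (slab 3 k)) := fun _ _ => Set.mem_univ _
  have key : ∀ x ∈ gammaZ k Γ z, (openGraph (cfgZ k ω Γ z)).Reachable z x := by
    intro x hx
    have h := connector_eq (L := Γ) hg
    have hx' : x ∈ z :: vline k (landCol k Γ z) (ht z) (ht g) := h ▸ hx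
    have hc : (z :: vline k (landCol k Γ z) (ht z) (ht g)).IsChain
        (fun a b => s(a, b) ∈ cfgZ k ω Γ z ∧ a ≠ b) := h ▸ hch
    exact reachable_of_openConnIn'' (openConnIn_head_of_mem z _ hc (fun _ _ => Set.mem_univ _) x hx')
  exact (key v hv).symm.trans (key g (last_mem_connector hg))

/-- **The needle property of `cfgZW` along `Γ_w`.** [cite: NewmanTassionWu2017, §4.1 (proof of Lemma 4.1, Steps 2–3)] -/
theorem cfgZW_needle (hω : ω ⊆ (slabGraph 3 k).edgeSet) (hz : ∃ g ∈ Γ, planarAdj (planar k z) (planar k g))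
    (hw : planarAdj (planar k w) (landCol k Γ z)) :
    ∀ (x q : slab 3 k) (m₁ m₂ : List (slab 3 k)), gammaW k Γ z w = m₁ ++ x :: m₂ → m₁ ≠ [] → m₂ ≠ [] →
      s(x, q) ∈ cfgZW k ω Γ z w →
      (∃ l₁ l₂, gammaW k Γ z w = l₁ ++ x :: q :: l₂) ∨ (∃ l₁ l₂, gammaW k Γ z w = l₁ ++ q :: x :: l₂) := by
  intro x q m₁ m₂ hl hm₁ hm₂ hxq
  obtain ⟨gw, hgw⟩ := exists_nearestOver_gammaW (w := w) hz
  have hwy : planar k w ≠ landCol k Γ z := ne_of_planarAdj'' hw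
  obtain ⟨hxy, hxL, -⟩ := inner_connector hgw hwy hl hm₁ hm₂
  have hxΓ : x ∉ Γ := fun h => hxL (List.mem_append_right _ h)
  have hxZ : x ∉ gammaZ k Γ z := fun h => hxL (List.mem_append_left _ h)
  have hE : s(x, q) ∈ edgesOf (gammaW k Γ z w) := by
    rcases hxq with (⟨hxqω, hxqS⟩ | h) | h
    · exact absurd (mem_surgS_of_adj hxy hxΓ ((SimpleGraph.mem_edgeSet _).1 (hω hxqω))) hxqS
    · exact absurd (mem_of_mem_edgesOf h).1 hxZ
    · exact h
  rcases next_of_mem_edgesOf (connector_nodup hgw hwy) hl hE with ⟨r', hr'⟩ | ⟨l₁', hl₁'⟩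
  · exact Or.inl ⟨m₁, r', by rw [hl, hr']⟩
  · exact Or.inr ⟨l₁', m₂, by rw [hl, hl₁']; simp⟩

/-- **No new circuit after Step 2.**  If `w` is not joined to any vertex of `Γ` by a `cfgZ`-open path
(Step 2's test, read after Steps 1 and 3 — reading (R2′)), every `cfgZW`-open circuit with at least
three vertices is `cfgZ`-open.  The needle `Γ_w` ends on `Γ_z ∪ Γ`, all of whose vertices are
`cfgZ`-joined to `Γ`. [cite: NewmanTassionWu2017, §4.1 (proof of Lemma 4.1: "If the construction uses Step 2, by the same argument, we would have … w(ω) ∈ C_{p_c}(Γ_min(ω)), or w(ω) ∈ C_{p_c}(z(ω))")] -/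
theorem isOpenCircuit_of_cfgZW (hω : ω ⊆ (slabGraph 3 k).edgeSet)
    (hz : ∃ g ∈ Γ, planarAdj (planar k z) (planar k g)) (hw : planarAdj (planar k w) (landCol k Γ z))
    (htest : ∀ g ∈ Γ, ¬ (openGraph (cfgZ k ω Γ z)).Reachable w g) {A : Set (slab 3 k)}
    {l : List (slab 3 k)} (hl : IsOpenCircuit k (cfgZW k ω Γ z w) A l) (h3 : 3 ≤ l.length) :
    IsOpenCircuit k (cfgZ k ω Γ z) A l := by
  obtain ⟨gw, hgw⟩ := exists_nearestOver_gammaW (w := w) hz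
  obtain ⟨g, hg⟩ := exists_nearestOver_gammaZ hz
  have hwy : planar k w ≠ landCol k Γ z := ne_of_planarAdj'' hw
  refine IsOpenCircuit.of_needle (connector_nodup hgw hwy) (connector_ne_nil _ _ _)
    (connector_head _ _ _) (connector_getLast hgw) (cfgZW_needle hω hz hw)
    (fun e he hne => ?_) (fun hconn => ?_) hl h3
  · rcases he with h | h
    · exact h
    · exact absurd h hne
  · have hwgw : (openGraph (cfgZ k ω Γ z)).Reachable w gw := (reachable_of_openConnIn'' hconn).symm
    rcases List.mem_append.1 (nearestOver_spec hgw).1 with hZ | hΓ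
    · exact htest g (nearestOver_spec hg).1 (hwgw.trans (reachable_cfgZ_of_mem_gammaZ hz hg hZ))
    · exact htest gw hΓ hwgw

/-- **`Γ_min` is unchanged by Steps 1–3** (`Γ = minCircuit`), under (f1) and the Step-2 test.
[cite: NewmanTassionWu2017, §4.1 (proof of Lemma 4.1, (f2): Γ_min(ω′) = Γ_min(ω))] -/
theorem minCircuit_cfgZW (hω : ω ⊆ (slabGraph 3 k).edgeSet) {c : ℤ × ℤ} {m n : ℕ}
    (hC : ω ∈ circuitAround k c m n) (hΓ : Γ = minCircuit k ω c m n)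
    (hz : ∃ g ∈ Γ, planarAdj (planar k z) (planar k g)) (hw : planarAdj (planar k w) (landCol k Γ z))
    (hf1 : ∀ g ∈ Γ, ¬ (openGraph ω).Reachable z g)
    (htest : ∀ g ∈ Γ, ¬ (openGraph (cfgZ k ω Γ z)).Reachable w g) :
    minCircuit k (cfgZW k ω Γ z w) c m n = Γ := by
  obtain ⟨⟨hΓc, hΓs⟩, hΓmin⟩ := minCircuit_spec hC
  rw [← hΓ] at hΓc hΓs hΓmin
  exact minCircuit_eq_of_min (isOpenCircuit_cfgZW hΓc) hΓs fun l hl hs =>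
    hΓmin l (isOpenCircuit_of_cfgZ hω hz hf1
      (isOpenCircuit_of_cfgZW hω hz hw htest hl (IsOpenCircuit.three_le_length_of_surrounds hs))
      (IsOpenCircuit.three_le_length_of_surrounds hs)) hs

/-- After Steps 1–3 the surrounding-circuit event still holds. [cite: NewmanTassionWu2017, §4.1 (ω′ ∈ C_{n_i,2n_i})] -/
theorem cfgZW_mem_circuitAround {c : ℤ × ℤ} {m n : ℕ} (hC : ω ∈ circuitAround k c m n)
    (hΓ : Γ = minCircuit k ω c m n) : cfgZW k ω Γ z w ∈ circuitAround k c m n := by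
  obtain ⟨⟨hΓc, hΓs⟩, -⟩ := minCircuit_spec hC
  rw [← hΓ] at hΓc hΓs
  exact ⟨Γ, isOpenCircuit_cfgZW hΓc, hΓs⟩

end StepW

/-! ## The closed dual surface survives (repair (R1)) -/

/-- A path inside `A` all of whose `G`-steps are `G'`-steps is a `G'`-path. [folklore] -/
private theorem pathIn_imp {V : Type*} {G G' : SimpleGraph V} {A : Set V} {u v : V}
    (h : PathIn G A u v) (hGG' : ∀ a b, a ∈ A → b ∈ A → G.Adj a b → G'.Adj a b) : PathIn G' A u v := by
  obtain ⟨hu, h⟩ := h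
  refine ⟨hu, ?_⟩
  induction h with
  | refl => exact Relation.ReflTransGen.refl
  | @tail b c hab hbc ih =>
    have hbA : b ∈ A := (show PathIn G A u b from ⟨hu, hab⟩).right_mem
    exact ih.tail ⟨hGG' b c hbA hbc.2 hbc.1, hbc.2⟩

/-- **A closed dual surface survives a surgery confined to the inner set.**  If every NEW open pair
of `ω'` has both endpoints over `X`, and `ω` has no open path inside `B̄` from `X̄` to `Ȳ`, then
neither has `ω'`: after its last visit to `X̄` such a path would use old pairs only.  (With
`X = B_{2n_i+1}`, `B = B_{m_i}`, `Y = ∂B_{m_i}` this is "`ω′ ∈ D_{2n_i+1,m_i}`", the plus cylinder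
`B̄₁^#(z′)` lying in `B̄_{2n_i+1}` — repair (R1) of the lane's scoping memo.)
[cite: NewmanTassionWu2017, §4.1 (proof of Lemma 4.1: "By construction, ω′ ∈ … 𝒴_A^i", the event D)] -/
theorem not_mem_slabConn_of_new_pairs {ω ω' : BondConfig (slab 3 k)} {B X Y : Set (ℤ × ℤ)}
    (hnew : ∀ e ∈ ω', e ∉ ω → ∀ v ∈ e, planar k v ∈ X) (h : ω ∉ slabConn k B X Y) :
    ω' ∉ slabConn k B X Y := by
  rintro ⟨x, hx, y, hy, hxy⟩
  apply h
  have hP : PathIn (openGraph ω') (slabLift k B) x y := mem_openConnIn_iff_pathIn.1 hxy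
  rcases hP.last_exit_or (C := slabLift k X) hx with hyX | ⟨a, b, haX, haB, hbX, hab, hP'⟩
  · exact ⟨y, hyX, y, hy, mem_openConnIn_iff_pathIn.2 (PathIn.refl hP.right_mem)⟩
  · -- the pair `(a, b)` and the path after it are old
    have hold : ∀ a b : slab 3 k, b ∉ slabLift k X → (openGraph ω').Adj a b → (openGraph ω).Adj a b := by
      intro a b hb hadj
      rw [openGraph_adj] at hadj ⊢
      refine ⟨?_, hadj.2⟩
      by_contra hω
      exact hb (hnew _ hadj.1 hω b (Sym2.mem_mk_right _ _))
    have hP'' : PathIn (openGraph ω) (slabLift k B \ slabLift k X) b y :=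
      pathIn_imp hP' fun a' b' _ hb' h' => hold a' b' hb'.2 h'
    have hab' : (openGraph ω).Adj a b := hold a b hbX hab
    refine ⟨a, haX, y, hy, mem_openConnIn_iff_pathIn.2 ?_⟩
    exact (PathIn.of_adj haB hP'.left_mem.1 hab').trans (hP''.mono fun _ hx => hx.1)

/-- The NEW open pairs of `cfgZ` lie on `Γ_z`, inside the plus cylinder. [cite: NewmanTassionWu2017, §4.1 (Step 1)] -/
theorem mem_plusEdges_of_mem_cfgZ_of_not_mem {ω : BondConfig (slab 3 k)} {Γ : List (slab 3 k)}
    {z : slab 3 k} (hz : ∃ g ∈ Γ, planarAdj (planar k z) (planar k g)) {e : Sym2 (slab 3 k)}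
    (he : e ∈ cfgZ k ω Γ z) (hne : e ∉ ω) : e ∈ plusEdges k (landCol k Γ z) := by
  by_contra hp
  exact hne ((mem_cfgZ_iff_of_not_mem_plusEdges hz hp).1 he)

/-- The NEW open pairs of `cfgZW` lie inside the plus cylinder. [cite: NewmanTassionWu2017, §4.1 (Steps 1–2)] -/
theorem mem_plusEdges_of_mem_cfgZW_of_not_mem {ω : BondConfig (slab 3 k)} {Γ : List (slab 3 k)}
    {z w : slab 3 k} (hz : ∃ g ∈ Γ, planarAdj (planar k z) (planar k g))
    (hw : planarAdj (planar k w) (landCol k Γ z)) {e : Sym2 (slab 3 k)}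
    (he : e ∈ cfgZW k ω Γ z w) (hne : e ∉ ω) : e ∈ plusEdges k (landCol k Γ z) := by
  by_contra hp
  exact hne ((mem_cfgZW_iff_of_not_mem_plusEdges hz hw hp).1 he)

/-- The plus cylinder about a point of `B_N` lies over `B_{N+1}`; hence so do the endpoints of its
edges. [cite: NewmanTassionWu2017, §4.1 (B̄₁^#(z′) ⊆ B̄_{2n_i+1}, repair (R1))] -/
theorem planar_mem_sqBox_succ_of_mem_plusEdges {y c : ℤ × ℤ} {N : ℕ} (hy : y ∈ sqBox c N)
    {e : Sym2 (slab 3 k)} (he : e ∈ plusEdges k y) {v : slab 3 k} (hv : v ∈ e) :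
    planar k v ∈ sqBox c (N + 1) :=
  mem_sqBox_add hy (plusCols_subset_sqBox y (he.2 v hv))

end NTW17

end Literature.Probability.Percolation
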